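import Summits.RiemannHypothesis.RiemannHypothesis.Theorems.SemilocalNegCertSixtySevenKinked2137PiecesA
import Summits.RiemannHypothesis.RiemannHypothesis.Theorems.SemilocalNegCertSixtySevenKinked2137PiecesB
import Summits.RiemannHypothesis.RiemannHypothesis.Theorems.HandoffLadderRungOne
import Summits.RiemannHypothesis.RiemannHypothesis.Theorems.HandoffUpperClausesC
import Summits.RiemannHypothesis.RiemannHypothesis.Theorems.SemilocalClassLaw
import Summits.RiemannHypothesis.RiemannHypothesis.Theorems.SemilocalLogAtomsE
import HarnessLib

/-!
# Semi-local threshold of the `{∞,2,…,67}` form, negative side: `a*({2,…,67}) ≤ 547 / 256 = 2.13671875` — the wall `q = 71` from a KINKED (piecewise-cubic) witness with slope breaks at the prime-atom images (part 28/28: the composition of the piece facts and the THEOREMS)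

Cell `rh-explicit` (HOME `run/shared/lean/pub/rh-explicit/`), seat cc-s2-9 gen3 (HUMAN RULING D-0074 (D5) WEIL data engine; LADDER-RH column WEIL, rung DATA → W-P(P2);
pipeline = cc-s2-4 gen8/gen11's piecewise-witness layer `SemilocalPiecewise{Witness,Increment,IncrementSum,Cert}.lean` + their float finder, every number
re-derived by an independent second engine E2 before filing; gen0/gen2 rows: `SemilocalNegCert{ThirteenKinked1423,…,FiftyThreeKinked2044}*`, capstone `SemilocalKinkedWallOffsets`).
HONEST FRAMING: RH-FREE theorems about the tree's `weilSemilocalThreshold S` of a TRUNCATED Weil form (finitely many places); nothing here bears on the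
truth of RH; the lower clause `(log q)/2 ≤ a*(S_q)` at all primes IS RH and is untouched; the SIGN of `δ*(71)` is not claimed.

KINKED row for the wall `q = 71` (`S = {2,…,67}`): at `b = 547 / 256 = 2.13671875 ≈ a*(S_71) + 0.0054` (DATA, two engines, cc-s2-6/cc-s2-3: `a*(S_71) = 2.1313625`)
the polynomial × indicator class is far from negative (tree row `549/256`, `SemilocalNegCertUptoSixtySeven`, `δ*(71) ≤ 0.0132`), whereas an odd piecewise cubic with slope breaks at the images
`|b − log n|` (rounded to `/1024`) of the atoms `n ∈ {3,5,7,11,13,17,19,23,29,31,37,41,43,47,53,59,61,67}` (the odd-prime atoms; all atom images resp. all primes resp. primes + 4 + 9 scanned, kit j257393) is negative by `3.032e-03·‖G‖²`.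
Instance: `S = {2, 3, 5, 7, 11, 13, 17, 19, 23, 29, 31, 37, 41, 43, 47, 53, 59, 61, 67}`, `N = 75` (atom table `atomsUptoSixtySeven` / `atomsEnclose_UptoSixtySeven` of `SemilocalNegCertUptoSixtySeven.lean`), 19 pieces of degree ≤ 3, 370 `t`-pieces;
TWO ENGINES on the witness before the kernel: cc-s2-4's float finder `λ_min = -3.0323e-03` and the seat's exact-in-`x` decimal engine E2 `R = -3.0396e-03` (no polar credit);
the exact kernel margin is the certificate's own rational arithmetic (farm report).  ⇒ **`a*({2,…,67}) ≤ 547 / 256`, `δ*(71) < 0.005379`** (was `0.0132`).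
No data is trusted: every bound is a `decide +kernel` fact.  Folklore throughout.
-/

set_option autoImplicit false
set_option linter.dupNamespace false  -- the mandated namespace repeats `RiemannHypothesis`
set_option Elab.async false  -- serialise the kernel facts: in parallel they exhaust the node's per-process heap (cc-s2-4 gen11, CC4-LEAN §16.10)

noncomputable section

open Complex Filter Set MeasureTheory Topology
open scoped Real

namespace Summit.RiemannHypothesis.RiemannHypothesis.Theorems.SemilocalPolyWitness

open MeasureTheory Set Finset Real
open Literature.NumberTheory.LFunctions
open Summit.RiemannHypothesis.RiemannHypothesis.Theorems.MotivicDoor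
open Summit.RiemannHypothesis.RiemannHypothesis.Theorems.MotivicDoor.SemilocalThreshold
open Summit.RiemannHypothesis.RiemannHypothesis.Theorems.MotivicDoor.SemilocalMarkov
open LQ

set_option maxRecDepth 4000 in  -- `i < cuts.length` unfolds a 370-element list
/-- all 370 pieces of `certSixtySevenKinked2137` check (the two half-range compositions `check_SixtySevenKinked2137_piecesA/B`). -/
theorem check_SixtySevenKinked2137_pieces : ∀ i, i < certSixtySevenKinked2137.cuts.length → certSixtySevenKinked2137.checkPiecePW i = true := by
  intro i hi
  have hi' : i < 370 := hi
  by_cases h : i < 192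
  · exact check_SixtySevenKinked2137_piecesA i h
  · exact check_SixtySevenKinked2137_piecesB i (Nat.not_lt.mp h) hi'

/-! ### The theorems -/

open Summit.RiemannHypothesis.RiemannHypothesis.Theorems.HandoffMarginLaw (wallOffset)

/-- **`a*(2,…,67) ≤ 547 / 256 = 2.13671875`** — the wall `q = 71` from the KINKED witness (the tree's polynomial row:
`549/256`, `SemilocalNegCertUptoSixtySeven`). RH-free. -/
theorem weilSemilocalThreshold_uptoSixtySeven_le_2137 :
    weilSemilocalThreshold {2, 3, 5, 7, 11, 13, 17, 19, 23, 29, 31, 37, 41, 43, 47, 53, 59, 61, 67} ≤ ((547 / 256 : ℚ) : ℝ) :=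
  weilSemilocalThreshold_le_of_checkPW_sharp certSixtySevenKinked2137 atomsEnclose_UptoSixtySeven
    check_SixtySevenKinked2137_main check_SixtySevenKinked2137_atoms check_SixtySevenKinked2137_pieces

/-- Failure form: positivity of the `{∞,2,…,67}` form fails on every cone `C(B)`, `B > 547 / 256`. -/
theorem not_weilSemilocalPositivityOn_uptoSixtySeven_of_gt_2137 {B : ℝ} (hB : (547 / 256 : ℝ) < B) :
    ¬ WeilSemilocalPositivityOn {2, 3, 5, 7, 11, 13, 17, 19, 23, 29, 31, 37, 41, 43, 47, 53, 59, 61, 67} B := by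
  rw [not_weilSemilocalPositivityOn_iff_weilSemilocalThreshold_lt]
  have h := weilSemilocalThreshold_uptoSixtySeven_le_2137
  push_cast at h
  linarith

/-- **`a*(S) ≤ 547 / 256` for every finite `S` of least missing prime `71`** (`{p < 71} ⊆ S ∌ 71`; the class of `71`, by first-gap locality
`SemilocalClassLaw.weilSemilocalThreshold_eq_of_classLawAt'` at the PROVED instance `semilocalClassLawAt_seventyone`). -/
theorem weilSemilocalThreshold_le_2137_of_mem {S : Finset ℕ} (hS : ∀ p : ℕ, p.Prime → p < 71 → p ∈ S) (h71 : 71 ∉ S) :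
    weilSemilocalThreshold S ≤ ((547 / 256 : ℚ) : ℝ) := by
  rw [SemilocalClassLaw.weilSemilocalThreshold_eq_of_classLawAt' (by norm_num) hS h71 SemilocalClassLaw.semilocalClassLawAt_seventyone,
    HandoffUpperClauses.primesBelow_seventyone]
  exact weilSemilocalThreshold_uptoSixtySeven_le_2137

/-- `a*(S_71) ≤ 547 / 256` in the `Nat.primesBelow` currency of the handoff / class-law files. -/
theorem weilSemilocalThreshold_primesBelow_seventyone_le_2137 :
    weilSemilocalThreshold (Nat.primesBelow 71) ≤ ((547 / 256 : ℚ) : ℝ) := by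
  rw [HandoffUpperClauses.primesBelow_seventyone]
  exact weilSemilocalThreshold_uptoSixtySeven_le_2137

/-- **Two-sided KERNEL bracket of the class of `71`**: `1 ≤ a*(S) ≤ 547 / 256` for every finite `S` with `{p < 71} ⊆ S ∌ 71`
(lower end: the `a = 1` rung through locality, `HandoffLadderRungOne.one_le_wall_of_ge_eight`; DATA `a*(S_71) = 2.1313625`). RH-free. -/
theorem weilSemilocalThreshold_mem_Icc_one_2137 {S : Finset ℕ} (hS : ∀ p : ℕ, p.Prime → p < 71 → p ∈ S) (h71 : 71 ∉ S) :
    weilSemilocalThreshold S ∈ Set.Icc (1 : ℝ) ((547 / 256 : ℚ) : ℝ) := by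
  rw [SemilocalClassLaw.weilSemilocalThreshold_eq_of_classLawAt' (by norm_num) hS h71 SemilocalClassLaw.semilocalClassLawAt_seventyone]
  exact ⟨HandoffLadderRungOne.one_le_wall_of_ge_eight (N := 71) (by norm_num), weilSemilocalThreshold_primesBelow_seventyone_le_2137⟩

/-- **The wall offset in the kernel**: `δ*(71) = a*(S_71) − (log 71)/2 ≤ 547 / 256 − (log 71)/2` (the polynomial row gave `549/256 − (log 71)/2`).
RH-free; the SIGN of `δ*(71)` is not claimed here. -/
theorem wallOffset_seventyone_le_2137 : wallOffset 71 ≤ 547 / 256 - Real.log 71 / 2 := by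
  have h := weilSemilocalThreshold_uptoSixtySeven_le_2137
  push_cast at h
  rw [wallOffset, HandoffUpperClauses.primesBelow_seventyone]
  push_cast
  linarith

/-- … numerically: **`δ*(71) < 0.005379`** (the tree's polynomial row: `0.0132`; DATA, two engines: `δ*(71) ≈ 2.3e-05`). RH-free. -/
theorem wallOffset_seventyone_lt_005379 : wallOffset 71 < 0.005379 := by
  have h := wallOffset_seventyone_le_2137
  have hl := log_seventyone_gt
  linarith

end Summit.RiemannHypothesis.RiemannHypothesis.Theorems.SemilocalPolyWitness

end
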